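import Summits.AtomisticToContinuum.BoseEinsteinCondensation.Theorems.BECCutLineWeakDisorderWitnessTransferRatio
import Literature.MathematicalPhysics.QuantumManyBody.GroundStateFeynmanKacTrialState
import Mathlib.MeasureTheory.Covering.BesicovitchVectorSpace
import Mathlib.MeasureTheory.Integral.Average
import HarnessLib

/-!
# Route BECCutLineWeakDisorder — `WitnessTransfer`, F: the landscape ratio under mollification

Support file (does not close the item) for item stmt-AtomisticToContinuum-14978
(`Summit.AtomisticToContinuum.BoseEinsteinCondensation.Theses.BECCutLineWeakDisorder.WitnessTransfer`,
`TwoReplicaTransienceBound → LandscapeBound`): the stub `stub_ratio_mollify` of the line sketch —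
the landscape ratio `∫ L³ m²/s² dY` of part I does not jump up when a ROUGH (bounded measurable)
`f ≥ 0` supported with a margin inside the box is replaced by its product mollification
`ρ_r ⋆ f = mollify hr f` (`GroundStateFeynmanKacTrialState`), frequently as `r → 0⁺`.

* `ae_tendsto_mollify` — Lebesgue points: `(ρ_{r_i} ⋆ g)(X) → g(X)` a.e. along `r_i → 0⁺` for
  locally integrable `g` (Besicovitch differentiation in the sup-metric space `(ℝ³)^N`, and the
  bound `ρ_r ≤ 8^N/|B̄_r|`, `mollifier_le_div_measureReal_closedBall`);
* `ae_ae_vecCons`, `ae_of_forall_ae_vecCons` — null sets of `(ℝ³)^{n+1}` versus null sets of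
  the slices `x ↦ x :: Y` (Tonelli);
* `mollify_le_mul_mollify_tailIndicator` — `ρ_r ⋆ f ≤ M · ρ_r ⋆ 1_{tail ∉ Z}`, `Z` the tails of
  a.e.-vanishing slices; the right side does not depend on the head coordinate;
* `tendsto_lintegral_ratio_mollify` — the ratios of `ρ_{r_i} ⋆ f` converge to that of `f`
  (slice masses converge for a.e. `Y`; zero slices are controlled by the previous item;
  dominated convergence of part I), whence `stub_ratio_mollify`.
-/

noncomputable section

open MeasureTheory Filter Set Metric
open scoped ENNReal NNReal Topology

namespace Summit.AtomisticToContinuum.BoseEinsteinCondensation.Theorems.CutLineWitness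

open Literature.MathematicalPhysics.QuantumManyBody.BoseGas

/-! ### Lebesgue points of the product mollification on `(ℝ³)^N` -/

section Config

variable {N : ℕ}

/-- Lebesgue measure on `(ℝ³)^N` is invariant under `X ↦ -X`. [folklore] -/
theorem isNegInvariant_volume_config : (volume : Measure (Config N)).IsNegInvariant := by
  refine ⟨?_⟩
  have h := Measure.map_addHaar_smul (volume : Measure (Config N)) (r := (-1 : ℝ)) (by norm_num)
  have hneg : (fun x : Config N => (-1 : ℝ) • x) = Neg.neg := by funext x; simp
  rw [hneg] at h
  rw [Measure.neg, h]
  simp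

/-- A bounded measurable real function on `(ℝ³)^N` is locally integrable. [folklore] -/
theorem locallyIntegrable_of_abs_le {g : Config N → ℝ} (hg : Measurable g) {M : ℝ}
    (hM : ∀ X, |g X| ≤ M) : LocallyIntegrable g volume :=
  (memLp_top_of_bound hg.aestronglyMeasurable M
    (Eventually.of_forall fun X => by rw [Real.norm_eq_abs]; exact hM X)).locallyIntegrable le_top

/-- **Sup bound of the mollifier**: `ρ_r(Y) ≤ 8^N / |B̄_r(X)|` for every `X` (each factor
`β_r ≤ 2³/|B̄_r|` as `rOut = 2 rIn`; sup-metric balls of `(ℝ³)^N` are products). [folklore] -/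
theorem mollifier_le_div_measureReal_closedBall {r : ℝ} (hr : 0 < r) (X Y : Config N) :
    mollifier hr Y ≤ 8 ^ N / volume.real (Metric.closedBall X r) := by
  have hfin : Module.finrank ℝ Space = 3 := finrank_euclideanSpace_fin
  have hone : ∀ i, (bumpOne hr).normed volume (Y i) ≤ 8 / volume.real (Metric.closedBall (X i) r) := by
    intro i
    have h := (bumpOne hr).normed_le_div_measure_closedBall_rOut volume 2
      (by simp only [bumpOne]; linarith) (Y i)
    rw [hfin, Measure.addHaar_real_closedBall_center volume (0 : Space)] at h
    rw [Measure.addHaar_real_closedBall_center volume (X i)]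
    have h8 : (2 : ℝ) ^ 3 = 8 := by norm_num
    have hrOut : (bumpOne hr).rOut = r := rfl
    rwa [h8, hrOut] at h
  calc mollifier hr Y = ∏ i, (bumpOne hr).normed volume (Y i) := rfl
    _ ≤ ∏ i, 8 / volume.real (Metric.closedBall (X i) r) :=
        Finset.prod_le_prod (fun i _ => (bumpOne hr).nonneg_normed _) fun i _ => hone i
    _ = 8 ^ N / ∏ i, volume.real (Metric.closedBall (X i) r) := by
        rw [Finset.prod_div_distrib, Finset.prod_const, Finset.card_univ, Fintype.card_fin]
    _ = 8 ^ N / volume.real (Metric.closedBall X r) := by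
        rw [measureReal_def, volume_pi_closedBall X hr.le, ENNReal.toReal_prod]
        rfl

/-- `(ρ_r ⋆ g)(X) = ∫ ρ_r(X - Z) g(Z) dZ` (translation and reflection invariance). [folklore] -/
theorem mollify_eq_integral_mollifier_sub {r : ℝ} (hr : 0 < r) (g : Config N → ℝ) (X : Config N) :
    mollify hr g X = ∫ Z, mollifier hr (X - Z) * g Z := by
  haveI := isNegInvariant_volume_config (N := N)
  rw [mollify, ← integral_sub_left_eq_self (fun Y => mollifier hr Y * g (X - Y)) volume X]
  simp only [sub_sub_cancel]

/-- **Mollification converges at Lebesgue points.** For locally integrable `g : (ℝ³)^N → ℝ` and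
radii `r_i → 0⁺`, `(ρ_{r_i} ⋆ g)(X) → g(X)` for a.e. `X` (Lebesgue differentiation along closed
sup-balls, Besicovitch; `ρ_r` is supported in `B̄_r` with `ρ_r ≤ 8^N/|B̄_r|`). [folklore] -/
theorem ae_tendsto_mollify {ι : Type*} {l : Filter ι} {r : ι → ℝ} (hr : ∀ i, 0 < r i)
    (hr0 : Tendsto r l (𝓝 0)) {g : Config N → ℝ} (hg : LocallyIntegrable g volume) :
    ∀ᵐ X : Config N, Tendsto (fun i => mollify (hr i) g X) l (𝓝 (g X)) := by
  haveI := isNegInvariant_volume_config (N := N)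
  filter_upwards [(Besicovitch.vitaliFamily (volume : Measure (Config N))).ae_tendsto_average_norm_sub
    hg] with X hX
  have hr' : Tendsto r l (𝓝[>] 0) := tendsto_nhdsWithin_iff.2 ⟨hr0, Eventually.of_forall hr⟩
  have hav := (hX.comp (Besicovitch.tendsto_filterAt volume X)).comp hr'
  have heq : (fun i => mollify (hr i) g X) = fun i => ∫ Z, mollifier (hr i) (X - Z) • g Z := by
    funext i
    rw [mollify_eq_integral_mollifier_sub]
    rfl
  rw [heq]
  refine tendsto_integral_smul_of_tendsto_average_norm_sub ((8 : ℝ) ^ N) hav ?_ ?_ ?_ ?_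
  · exact Eventually.of_forall fun i => hg.integrableOn_isCompact (isCompact_closedBall _ _)
  · refine tendsto_const_nhds.congr fun i => ?_
    rw [integral_sub_left_eq_self (mollifier (hr i)) volume X, integral_mollifier]
  · refine Eventually.of_forall fun i => fun Z hZ => ?_
    rw [Metric.mem_closedBall, dist_eq_norm_sub']
    exact (norm_lt_of_mollifier_ne_zero (hr i) hZ).le
  · refine Eventually.of_forall fun i => fun Z => ?_
    rw [abs_of_nonneg (mollifier_nonneg _ _)]
    exact mollifier_le_div_measureReal_closedBall (hr i) X (X - Z)

end Config

/-! ### Slices `x ↦ x :: Y`: null sets, the tail indicator, dominated convergence -/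

variable {n : ℕ}

/-- An a.e. statement on `(ℝ³)^{n+1}` holds, for a.e. tail `Y`, for a.e. head `x` at `x :: Y`
(Tonelli for null sets through `(x, Y) ↦ x :: Y`). [folklore] -/
theorem ae_ae_vecCons {p : Config (n + 1) → Prop} (h : ∀ᵐ X : Config (n + 1), p X) :
    ∀ᵐ Y : Config n, ∀ᵐ x : Space, p (Matrix.vecCons x Y) := by
  have hmp : MeasurePreserving (fun q : Config n × Space => Matrix.vecCons q.2 q.1)
      ((volume : Measure (Config n)).prod (volume : Measure Space)) volume :=
    measurePreserving_vecCons.comp Measure.measurePreserving_swap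
  exact Measure.ae_ae_of_ae_prod (hmp.quasiMeasurePreserving.ae h)

/-- Conversely, a measurable statement holding for every tail `Y` at a.e. head `x` holds a.e. on
`(ℝ³)^{n+1}`. [folklore] -/
theorem ae_of_forall_ae_vecCons {p : Config (n + 1) → Prop} (hp : MeasurableSet {X | p X})
    (h : ∀ Y : Config n, ∀ᵐ x : Space, p (Matrix.vecCons x Y)) : ∀ᵐ X : Config (n + 1), p X := by
  have hS : MeasurableSet {X | ¬p X} := hp.compl
  rw [ae_iff, ← lintegral_indicator_one hS, lintegral_config_succ (measurable_one.indicator hS)]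
  have h0 : ∀ Y : Config n, ∫⁻ x : Space, {X | ¬p X}.indicator 1 (Matrix.vecCons x Y) = 0 := by
    intro Y
    refine (lintegral_eq_zero_iff' ((measurable_one.indicator hS).comp
      (measurable_vecCons.comp (measurable_id.prodMk measurable_const))).aemeasurable).2 ?_
    filter_upwards [h Y] with x hx
    simp [hx]
  simp [h0]

/-- The tail map `X ↦ (X₁, …, X_n)` of `(ℝ³)^{n+1}` is measurable. [folklore] -/
theorem measurable_vecTail : Measurable (Matrix.vecTail : Config (n + 1) → Config n) :=
  measurable_pi_lambda _ fun _ => measurable_pi_apply _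

/-- The mollification of an indicator of the tail does not depend on the head coordinate:
`(ρ_r ⋆ 1_{tail ∈ S})(x :: Y) = (ρ_r ⋆ 1_{tail ∈ S})(x' :: Y)`. [folklore] -/
theorem mollify_tailIndicator_vecCons {r : ℝ} (hr : 0 < r) (S : Set (Config n)) (x x' : Space)
    (Y : Config n) :
    mollify hr ({X : Config (n + 1) | Matrix.vecTail X ∈ S}.indicator fun _ => (1 : ℝ))
        (Matrix.vecCons x Y) =
      mollify hr ({X : Config (n + 1) | Matrix.vecTail X ∈ S}.indicator fun _ => (1 : ℝ))
        (Matrix.vecCons x' Y) := by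
  show (∫ W, mollifier hr W * _) = ∫ W, mollifier hr W * _
  refine integral_congr_ae (Eventually.of_forall fun W => ?_)
  have hiff : ∀ z : Space, Matrix.vecCons z Y - W ∈ {X : Config (n + 1) | Matrix.vecTail X ∈ S} ↔
      Y - Matrix.vecTail W ∈ S := fun z => by
    have : Matrix.vecTail (Matrix.vecCons z Y - W) = Y - Matrix.vecTail W := by
      funext i; simp [Matrix.vecTail]
    rw [Set.mem_setOf_eq, this]
  simp only
  by_cases hS : Y - Matrix.vecTail W ∈ S
  · rw [Set.indicator_of_mem ((hiff x).2 hS), Set.indicator_of_mem ((hiff x').2 hS)]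
  · rw [Set.indicator_of_notMem (fun h => hS ((hiff x).1 h)),
      Set.indicator_of_notMem (fun h => hS ((hiff x').1 h))]

/-- **The zero-slice estimate.** For measurable `|f| ≤ M` on `(ℝ³)^{n+1}` and
`S = {Y | ∫ |f(x :: Y)| dx ≠ 0}` (tails of non-vanishing slices),
`ρ_r ⋆ f ≤ M · ρ_r ⋆ 1_{tail ∈ S}` everywhere: `f ≤ M 1_{tail ∈ S}` a.e. (on a slice outside `S`,
`f = 0` a.e.), and mollification is monotone on a.e. inequalities. [folklore] -/
theorem mollify_le_mul_mollify_tailIndicator {f : Config (n + 1) → ℝ} (hfm : Measurable f) {M : ℝ}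
    (hM : ∀ X, |f X| ≤ M) {r : ℝ} (hr : 0 < r) (X : Config (n + 1)) :
    mollify hr f X ≤ M * mollify hr ({V : Config (n + 1) | Matrix.vecTail V ∈
      {Y : Config n | ∫⁻ x, (‖f (Matrix.vecCons x Y)‖₊ : ℝ≥0∞) ≠ 0}}.indicator fun _ => (1 : ℝ)) X := by
  haveI := isNegInvariant_volume_config (N := n + 1)
  set T : Set (Config (n + 1)) := {V : Config (n + 1) | Matrix.vecTail V ∈
      {Y : Config n | ∫⁻ x, (‖f (Matrix.vecCons x Y)‖₊ : ℝ≥0∞) ≠ 0}} with hT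
  have hTm : MeasurableSet T :=
    (measurable_lintegral_nnnorm_vecCons hfm).comp measurable_vecTail (measurableSet_singleton 0).compl
  set H : Config (n + 1) → ℝ := T.indicator fun _ => (1 : ℝ) with hH
  have hHm : Measurable H := measurable_const.indicator hTm
  -- `f ≤ M H` almost everywhere
  have hae : ∀ᵐ V : Config (n + 1), f V ≤ M * H V := by
    refine ae_of_forall_ae_vecCons (measurableSet_le hfm (measurable_const.mul hHm)) fun Y => ?_
    by_cases hY : ∫⁻ x, (‖f (Matrix.vecCons x Y)‖₊ : ℝ≥0∞) ≠ 0
    · refine Eventually.of_forall fun x => ?_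
      have hmem : Matrix.vecCons x Y ∈ T := by simpa [hT] using hY
      rw [hH, Set.indicator_of_mem hmem, mul_one]
      exact (le_abs_self _).trans (hM _)
    · rw [not_ne_iff] at hY
      filter_upwards [(lintegral_eq_zero_iff
        (measurable_slice hfm Y).nnnorm.coe_nnreal_ennreal).1 hY] with x hx
      have hx0 : f (Matrix.vecCons x Y) = 0 := by simpa using hx
      have hnot : Matrix.vecCons x Y ∉ T := by simp [hT, hY]
      rw [hx0, hH, Set.indicator_of_notMem hnot, mul_zero]
  -- transport along `W ↦ X - W` and integrate against `ρ_r`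
  have hae' : ∀ᵐ W : Config (n + 1),
      mollifier hr W * f (X - W) ≤ mollifier hr W * (M * H (X - W)) := by
    filter_upwards [(Measure.measurePreserving_sub_left volume X).quasiMeasurePreserving.ae hae]
      with W hW
    exact mul_le_mul_of_nonneg_left hW (mollifier_nonneg hr W)
  have hHb : ∀ V, |M * H V| ≤ |M| := by
    intro V
    rw [abs_mul]
    refine mul_le_of_le_one_right (abs_nonneg M) ?_
    rw [hH, Set.indicator_apply]
    split_ifs <;> simp
  calc mollify hr f X = ∫ W, mollifier hr W * f (X - W) := rfl
    _ ≤ ∫ W, mollifier hr W * (M * H (X - W)) :=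
        integral_mono_ae (integrable_mollifier_mul hr hfm hM X)
          (integrable_mollifier_mul hr (measurable_const.mul hHm) hHb X) hae'
    _ = M * ∫ W, mollifier hr W * H (X - W) := by
        rw [← integral_const_mul]
        refine integral_congr_ae (Eventually.of_forall fun W => ?_)
        simp only
        ring
    _ = M * mollify hr H X := rfl

/-- **Dominated convergence of the slice masses, a.e. version**: for measurable `g_i` with
`|g_i| ≤ K`, supported in `Λ_L`, converging almost everywhere to `g`, `∫ |g_i|^p → ∫ |g|^p`
(`p ≥ 1`). [folklore] -/
theorem tendsto_lintegral_nnnorm_pow_of_ae {ι : Type*} {l : Filter ι} [l.IsCountablyGenerated]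
    {L K : ℝ} {g : ι → Space → ℝ} {g₀ : Space → ℝ} (hgm : ∀ i, Measurable (g i))
    (hbound : ∀ i x, |g i x| ≤ K) (hsupp : ∀ i x, x ∉ box L → g i x = 0)
    (hlim : ∀ᵐ x : Space, Tendsto (fun i => g i x) l (𝓝 (g₀ x))) {p : ℕ} (hp : p ≠ 0) :
    Tendsto (fun i => ∫⁻ x, (‖g i x‖₊ : ℝ≥0∞) ^ p) l (𝓝 (∫⁻ x, (‖g₀ x‖₊ : ℝ≥0∞) ^ p)) := by
  refine tendsto_lintegral_filter_of_dominated_convergence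
    ((box L).indicator fun _ => ENNReal.ofReal K ^ p) ?_ ?_ ?_ ?_
  · exact Eventually.of_forall fun i => (hgm i).nnnorm.coe_nnreal_ennreal.pow_const p
  · refine Eventually.of_forall fun i => Eventually.of_forall fun x => ?_
    by_cases hx : x ∈ box L
    · rw [Set.indicator_of_mem hx]
      exact pow_le_pow_left' (coe_nnnorm_le_ofReal (hbound i x)) p
    · rw [Set.indicator_of_notMem hx, hsupp i x hx]
      simp [hp]
  · rw [lintegral_indicator (measurableSet_box L), setLIntegral_const]
    exact ENNReal.mul_ne_top (ENNReal.pow_ne_top ENNReal.ofReal_ne_top) (volume_box_ne_top L)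
  · filter_upwards [hlim] with x hx
    exact ENNReal.Tendsto.pow ((ENNReal.continuous_coe.tendsto _).comp hx.nnnorm)

/-! ### The landscape ratio under mollification -/

/-- The mollification at radius `r ≤ r₀` of a function supported with margin `r₀` inside
`Λ_L^{n+1}` still vanishes off the box. [folklore] -/
theorem mollify_eq_zero_of_margin {L : ℝ} {f : Config (n + 1) → ℝ} {r₀ r : ℝ} (hr : 0 < r)
    (hrr₀ : r ≤ r₀) (h0 : ∀ X, f X ≠ 0 → Metric.closedBall X r₀ ⊆ boxN (n + 1) L)
    (X : Config (n + 1)) (hX : X ∉ boxN (n + 1) L) : mollify hr f X = 0 := by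
  refine mollify_eq_zero hr fun Y hY => ?_
  by_contra h
  refine hX (h0 _ h ?_)
  rw [Metric.mem_closedBall, dist_eq_norm, sub_sub_cancel]
  exact hY.le.trans hrr₀

/-- **The landscape ratio is continuous under mollification along `r → 0⁺`.** For measurable
`0 ≤ f ≤ M` on `(ℝ³)^{n+1}` supported with margin `r₀` inside `Λ_L^{n+1}` and radii
`0 < r_i ≤ r₀`, `r_i → 0`: `∫ L³ m_{ρ_{r_i}⋆f}²/s_{ρ_{r_i}⋆f}² dY → ∫ L³ m_f²/s_f² dY`.
Slice masses converge for a.e. `Y` (Lebesgue points of `f`, Tonelli, dominated convergence in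
`x`); at slices of positive mass the integrand is continuous, at slices of zero mass it is
`≤ L³ (M u_i(Y))²` with `u_i = ρ_{r_i} ⋆ 1_{non-vanishing slices} → 0` a.e. on the vanishing ones;
dominated convergence in `Y` (part I). [folklore] -/
theorem tendsto_lintegral_ratio_mollify {ι : Type*} {l : Filter ι} [l.IsCountablyGenerated]
    {L : ℝ} {f : Config (n + 1) → ℝ} (hfm : Measurable f) {M : ℝ} (hM : ∀ X, |f X| ≤ M)
    (hnn : ∀ X, 0 ≤ f X) {r₀ : ℝ} (hr₀ : 0 < r₀)
    (h0 : ∀ X, f X ≠ 0 → Metric.closedBall X r₀ ⊆ boxN (n + 1) L) {r : ι → ℝ}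
    (hr : ∀ i, 0 < r i) (hrr₀ : ∀ i, r i ≤ r₀) (hr0 : Tendsto r l (𝓝 0)) :
    Tendsto (fun i => ∫⁻ Y : Config n, ENNReal.ofReal (L ^ 3) *
        (∫⁻ x, (‖mollify (hr i) f (Matrix.vecCons x Y)‖₊ : ℝ≥0∞) ^ 2) ^ 2 /
          (∫⁻ x, (‖mollify (hr i) f (Matrix.vecCons x Y)‖₊ : ℝ≥0∞)) ^ 2) l
      (𝓝 (∫⁻ Y : Config n, ENNReal.ofReal (L ^ 3) *
        (∫⁻ x, (‖f (Matrix.vecCons x Y)‖₊ : ℝ≥0∞) ^ 2) ^ 2 /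
          (∫⁻ x, (‖f (Matrix.vecCons x Y)‖₊ : ℝ≥0∞)) ^ 2)) := by
  set g : ι → Config (n + 1) → ℝ := fun i => mollify (hr i) f with hg
  have hf0 : ∀ X, X ∉ boxN (n + 1) L → f X = 0 := fun X hX => by
    by_contra h
    exact hX (h0 X h (Metric.mem_closedBall_self hr₀.le))
  have hgm : ∀ i, Measurable (g i) := fun i =>
    (contDiff_mollify (hr i) (locallyIntegrable_of_abs_le hfm hM)).continuous.measurable
  have hgb : ∀ i X, |g i X| ≤ M := fun i X => abs_mollify_le (hr i) hM X
  have hgs : ∀ i X, X ∉ boxN (n + 1) L → g i X = 0 :=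
    fun i X hX => mollify_eq_zero_of_margin (hr i) (hrr₀ i) h0 X hX
  refine tendsto_lintegral_ratio hgm hgb hgs ?_
  -- (1) a.e. convergence of the mollifications, sliced
  have h1 : ∀ᵐ Y : Config n, ∀ᵐ x : Space,
      Tendsto (fun i => g i (Matrix.vecCons x Y)) l (𝓝 (f (Matrix.vecCons x Y))) :=
    ae_ae_vecCons (ae_tendsto_mollify hr hr0 (locallyIntegrable_of_abs_le hfm hM))
  -- (2) the mollified indicator of the non-vanishing slices converges to it a.e.
  set T : Set (Config (n + 1)) := {V : Config (n + 1) | Matrix.vecTail V ∈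
      {Y : Config n | ∫⁻ x, (‖f (Matrix.vecCons x Y)‖₊ : ℝ≥0∞) ≠ 0}} with hT
  have hTm : MeasurableSet T :=
    (measurable_lintegral_nnnorm_vecCons hfm).comp measurable_vecTail (measurableSet_singleton 0).compl
  set H : Config (n + 1) → ℝ := T.indicator fun _ => (1 : ℝ) with hH
  have hHm : Measurable H := measurable_const.indicator hTm
  have hHb : ∀ V, |H V| ≤ 1 := fun V => by
    rw [hH, Set.indicator_apply]
    split_ifs <;> simp
  have h2 : ∀ᵐ Y : Config n, Tendsto (fun i => mollify (hr i) H (Matrix.vecCons 0 Y)) l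
      (𝓝 (H (Matrix.vecCons 0 Y))) := by
    filter_upwards [ae_ae_vecCons
      (ae_tendsto_mollify hr hr0 (locallyIntegrable_of_abs_le hHm hHb))] with Y hY
    have hY' : ∀ᵐ _x : Space, Tendsto (fun i => mollify (hr i) H (Matrix.vecCons 0 Y)) l
        (𝓝 (H (Matrix.vecCons 0 Y))) := by
      filter_upwards [hY] with x hx
      have e1 : ∀ i, mollify (hr i) H (Matrix.vecCons x Y) = mollify (hr i) H (Matrix.vecCons 0 Y) :=
        fun i => mollify_tailIndicator_vecCons (hr i) _ x 0 Y
      have e2 : H (Matrix.vecCons x Y) = H (Matrix.vecCons 0 Y) := by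
        simp only [hH, hT, Set.indicator_apply, Set.mem_setOf_eq, Matrix.tail_cons]
      simpa only [e1, e2] using hx
    exact eventually_const.1 hY'
  filter_upwards [h1, h2] with Y hY1 hY2
  -- slice masses of `g i` converge
  have hsm : ∀ i, Measurable fun x : Space => g i (Matrix.vecCons x Y) :=
    fun i => measurable_slice (hgm i) Y
  have hsb : ∀ i (x : Space), |g i (Matrix.vecCons x Y)| ≤ M := fun i x => hgb i _
  have hss : ∀ i (x : Space), x ∉ box L → g i (Matrix.vecCons x Y) = 0 :=
    fun i x hx => hgs i _ fun h => hx (vecCons_mem_boxN_iff.1 h).1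
  have hm := tendsto_lintegral_nnnorm_pow_of_ae hsm hsb hss hY1 two_ne_zero
  have hs : Tendsto (fun i => ∫⁻ x, (‖g i (Matrix.vecCons x Y)‖₊ : ℝ≥0∞)) l
      (𝓝 (∫⁻ x, (‖f (Matrix.vecCons x Y)‖₊ : ℝ≥0∞))) := by
    simpa using tendsto_lintegral_nnnorm_pow_of_ae hsm hsb hss hY1 one_ne_zero
  have hsfin : ∫⁻ x, (‖f (Matrix.vecCons x Y)‖₊ : ℝ≥0∞) ≠ ⊤ :=
    ne_top_of_le_ne_top (ENNReal.mul_ne_top ENNReal.ofReal_ne_top (volume_box_ne_top L))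
      (lintegral_nnnorm_le_of_bound (fun x => hM _)
        (fun x hx => hf0 _ fun h => hx (vecCons_mem_boxN_iff.1 h).1))
  have hms : ∫⁻ x, (‖f (Matrix.vecCons x Y)‖₊ : ℝ≥0∞) ^ 2 ≤
      ENNReal.ofReal M * ∫⁻ x, (‖f (Matrix.vecCons x Y)‖₊ : ℝ≥0∞) :=
    lintegral_sq_le_mul_lintegral fun x => hM _
  by_cases hpos : ∫⁻ x, (‖f (Matrix.vecCons x Y)‖₊ : ℝ≥0∞) ≠ 0
  · -- slice of positive mass: continuity of `m²/s²`
    exact tendsto_mul_sq_div_sq ENNReal.ofReal_ne_top hm hs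
      (ne_top_of_le_ne_top (ENNReal.mul_ne_top ENNReal.ofReal_ne_top hsfin) hms) hpos hsfin
  -- slice of zero mass: the mollified indicator controls the integrand
  rw [not_ne_iff] at hpos
  have hm0 : ∫⁻ x, (‖f (Matrix.vecCons x Y)‖₊ : ℝ≥0∞) ^ 2 = 0 :=
    le_zero_iff.1 (hms.trans (by rw [hpos, mul_zero]))
  have hH0 : H (Matrix.vecCons 0 Y) = 0 := by
    simp only [hH, hT, Set.indicator_apply, Set.mem_setOf_eq, Matrix.tail_cons, hpos]
    simp
  have hlimit : ENNReal.ofReal (L ^ 3) * (∫⁻ x, (‖f (Matrix.vecCons x Y)‖₊ : ℝ≥0∞) ^ 2) ^ 2 /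
      (∫⁻ x, (‖f (Matrix.vecCons x Y)‖₊ : ℝ≥0∞)) ^ 2 = 0 := by
    rw [hpos, hm0]; simp
  rw [hlimit]
  rw [hH0] at hY2
  -- the bound `I(g i)(Y) ≤ L³ (M u_i)²`, `u_i = (ρ_{r_i} ⋆ H)(0 :: Y) → 0`
  have hU : ∀ i (x : Space), |g i (Matrix.vecCons x Y)| ≤ M * mollify (hr i) H (Matrix.vecCons 0 Y) :=
    fun i x => by
    rw [abs_of_nonneg (mollify_nonneg (hr i) hnn _), ← mollify_tailIndicator_vecCons (hr i) _ x 0 Y]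
    exact mollify_le_mul_mollify_tailIndicator hfm hM (hr i) _
  have hlimU : Tendsto (fun i => ENNReal.ofReal (L ^ 3) *
      ENNReal.ofReal (M * mollify (hr i) H (Matrix.vecCons 0 Y)) ^ 2) l (𝓝 0) := by
    have t2 : Tendsto (fun i => ENNReal.ofReal (M * mollify (hr i) H (Matrix.vecCons 0 Y))) l
        (𝓝 0) := by
      simpa using ENNReal.tendsto_ofReal (hY2.const_mul M)
    simpa using ENNReal.Tendsto.const_mul (ENNReal.Tendsto.pow (n := 2) t2)
      (Or.inr ENNReal.ofReal_ne_top) (a := ENNReal.ofReal (L ^ 3))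
  exact tendsto_of_tendsto_of_tendsto_of_le_of_le tendsto_const_nhds hlimU (fun _ => zero_le)
    fun i => mul_sq_div_sq_le (lintegral_sq_le_mul_lintegral (hU i))

/-- **(F) The landscape ratio does not jump up under mollification.** For measurable
`0 ≤ f ≤ M` on `(ℝ³)^{n+1}` supported with a margin `r₀` inside `Λ_L^{n+1}` (so that the
mollifications `ρ_r ∗ f`, `r ≤ r₀`, still vanish off the box) and `ε > 0`: frequently as `r → 0+`,
`∫ L³ m_{ρ_r∗f}²/s_{ρ_r∗f}² ≤ ∫ L³ m_f²/s_f² + ε` (along `r_j = r₀/(j+1)` the ratios converge,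
`tendsto_lintegral_ratio_mollify`). [folklore] -/
theorem stub_ratio_mollify {n : ℕ} {L : ℝ} {f : Config (n + 1) → ℝ} (hfm : Measurable f) {M : ℝ}
    (hM : ∀ X, |f X| ≤ M) (hnn : ∀ X, 0 ≤ f X) {r₀ : ℝ} (hr₀ : 0 < r₀)
    (h0 : ∀ X, f X ≠ 0 → Metric.closedBall X r₀ ⊆ boxN (n + 1) L)
    {ε : ℝ≥0∞} (hε : 0 < ε) :
    ∃ᶠ r in 𝓝[>] (0 : ℝ), ∀ hr : 0 < r,
      ∫⁻ Y : Config n, ENNReal.ofReal (L ^ 3) *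
          (∫⁻ x, (‖mollify hr f (Matrix.vecCons x Y)‖₊ : ℝ≥0∞) ^ 2) ^ 2 /
            (∫⁻ x, (‖mollify hr f (Matrix.vecCons x Y)‖₊ : ℝ≥0∞)) ^ 2 ≤
        (∫⁻ Y : Config n, ENNReal.ofReal (L ^ 3) *
          (∫⁻ x, (‖f (Matrix.vecCons x Y)‖₊ : ℝ≥0∞) ^ 2) ^ 2 /
            (∫⁻ x, (‖f (Matrix.vecCons x Y)‖₊ : ℝ≥0∞)) ^ 2) + ε := by
  set r : ℕ → ℝ := fun j => r₀ / ((j : ℝ) + 1) with hrdef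
  have hrpos : ∀ j, 0 < r j := fun j => div_pos hr₀ (Nat.cast_add_one_pos j)
  have hrr₀ : ∀ j, r j ≤ r₀ := fun j =>
    div_le_self hr₀.le (le_add_of_nonneg_left (Nat.cast_nonneg j))
  have hr0 : Tendsto r atTop (𝓝 0) :=
    tendsto_const_nhds.div_atTop (tendsto_atTop_add_const_right _ _ tendsto_natCast_atTop_atTop)
  have hten : Tendsto r atTop (𝓝[>] 0) :=
    tendsto_nhdsWithin_iff.2 ⟨hr0, Eventually.of_forall hrpos⟩
  have hR := tendsto_lintegral_ratio_mollify (l := atTop) hfm hM hnn hr₀ h0 hrpos hrr₀ hr0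
  refine hten.frequently (Eventually.frequently ?_)
  set Rf := ∫⁻ Y : Config n, ENNReal.ofReal (L ^ 3) *
      (∫⁻ x, (‖f (Matrix.vecCons x Y)‖₊ : ℝ≥0∞) ^ 2) ^ 2 /
        (∫⁻ x, (‖f (Matrix.vecCons x Y)‖₊ : ℝ≥0∞)) ^ 2 with hRf
  rcases eq_or_ne Rf ⊤ with htop | htop
  · exact Eventually.of_forall fun j _ => by rw [htop, top_add]; exact le_top
  · filter_upwards [hR.eventually (gt_mem_nhds (ENNReal.lt_add_right htop hε.ne'))] with j hj
    exact fun _ => hj.le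

end Summit.AtomisticToContinuum.BoseEinsteinCondensation.Theorems.CutLineWitness

end
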